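import Summits.SmoothPoincare4.SmoothPoincare4.Theses.InformationMetricHadamard
import Summits.SmoothPoincare4.SmoothPoincare4.Theorems.AhHadamardFilling.Negative.HyperbolicConeCollar
import Literature.Geometry.Riemannian.HyperboloidCartanHadamard
import Literature.Geometry.Riemannian.RoundSphere
import Mathlib.Geometry.Manifold.LocalDiffeomorph

/-!
# `SmoothPoincare4 → AhHadamardFilling`: the crux is implied by the summit (hardness record)

Negative side of crux `InformationMetricHadamard.AhHadamardFilling` (item stmt-SmoothPoincare4-6014,
line `Sketch`, lead continuation c1). The route's KILL CRITERIA assert that refuting the crux "is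
equivalent to exhibiting an exotic 4-sphere (both follow from SPC4: hyperbolic 5-space in geodesic
polar coordinates is the model witness)"; this file PROVES that direction:

* `ahHadamardFilling_of_smoothPoincare4 : SmoothPoincare4 → AhHadamardFilling` — given SPC4, a
  homotopy 4-sphere `S` is diffeomorphic to `S⁴ ⊂ ℝ⁵` by `d`; take `W = ℍ⁵` in the graph chart of
  the hyperboloid model (`Hyperboloid.metric ⊤` on `⊤ : Opens ℝ⁵`: complete, simply connected,
  `sec ≤ 0` — `Literature/Geometry/Riemannian/HyperboloidCartanHadamard.lean`), `g = d^*(round)`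
  (the metric induced from `⟪·,·⟫` by `f = ι ∘ d`), `c = 1` and the cone collar
  `Φ(σ, λ) = λ⁻¹ f(σ)` (`HyperbolicConeCollar.lean`: smooth, injective, far parts `{‖u‖ > 1/t}`
  co-compact with the closure clause, and `G(dΦ(v,s), dΦ(v,s)) = (‖df v‖² + s²/(λ²+1)·λ²…)/λ²`
  exactly, whence the `C⁰` cone asymptotics with `t = √ε ⊓ ½`);
* `not_smoothPoincare4_of_not_ahHadamardFilling` — contrapositive: **a refutation of the crux is a
  disproof of SPC4** (an exotic 4-sphere).

Together with the line's kernel-checked `smoothPoincare4_of_stubs` (X ∧ K1 ⇒ SPC4, skeleton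
`Cruxes/AhHadamardFilling/Lines/Sketch.lean`) this pins the crux between its open stub X and the
summit: `X ⇒ SmoothPoincare4 ⇒ AhHadamardFilling`.
-/

noncomputable section

open Bundle Set TopologicalSpace Function Metric Module
open scoped Manifold ContDiff Topology RealInnerProductSpace NNReal

namespace Summit.SmoothPoincare4.SmoothPoincare4.Theorems.AhHadamardFilling.Negative

open Literature.Geometry.Riemannian Literature.Geometry.Riemannian.Hyperboloid
open Literature.Geometry.Lorentzian Literature.Geometry.Lorentzian.PseudoRiemannianMetric
open Literature.Topology.FourManifolds (HomotopySphere)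

-- the prescribed namespace `Summit.<P>.<Sub>.…` duplicates `SmoothPoincare4` (P = Sub)
set_option linter.dupNamespace false
-- instance search through the nested operator type `ℝ⁵ →L[ℝ] ℝ⁵ →L[ℝ] ℝ` of the metric components
set_option maxSynthPendingDepth 3

/-- **`SmoothPoincare4 → AhHadamardFilling`** (the crux follows from the summit; model witness
`W = ℍ⁵`, Lee 2018, Thm. 3.7 / Example 12.10, with the cone collar over `S ≅ S⁴ ⊂ ℝ⁵`).
[cite: Lee2018, Thm. 3.7 and Example 12.10] -/
theorem ahHadamardFilling_of_smoothPoincare4 (hSPC4 : _root_.SmoothPoincare4) :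
    Summit.SmoothPoincare4.SmoothPoincare4.Theses.InformationMetricHadamard.AhHadamardFilling := by
  intro S
  obtain ⟨e⟩ := S.nonempty_homotopyEquiv
  obtain ⟨d⟩ := hSPC4 S.carrier S.chartedSpace S.isManifold e
  -- the immersion `f = ι ∘ d : S → ℝ⁵` onto the unit sphere
  haveI : Fact (finrank ℝ (EuclideanSpace ℝ (Fin (4 + 1))) = 4 + 1) :=
    Fact.mk (@finrank_euclideanSpace_fin ℝ _ (4 + 1))
  set f : S.carrier → (EuclideanSpace ℝ (Fin 5)) :=
    (Subtype.val : sphere (0 : EuclideanSpace ℝ (Fin (4 + 1))) 1 → EuclideanSpace ℝ (Fin (4 + 1))) ∘ d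
    with hfdef
  have h1 : ∀ x, ‖f x‖ = 1 := fun x ↦ by simp [hfdef]
  have hinj : Injective f := Subtype.val_injective.comp d.injective
  have hsurj : ∀ y : (EuclideanSpace ℝ (Fin 5)), ‖y‖ = 1 → y ∈ range f := fun y hy ↦
    ⟨d.symm ⟨y, by simpa using hy⟩, by simp [hfdef]⟩
  have hfm : ∀ m : ℕ∞ω, m ≤ ∞ → ContMDiff (𝓡 4) (𝓡 5) m f := fun m hm ↦
    (contMDiff_coe_sphere (E := EuclideanSpace ℝ (Fin (4 + 1))) (n := 4)).comp
      (d.contMDiff.of_le hm)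
  have hf : ContMDiff (𝓡 4) (𝓡 5) ∞ f := hfm ∞ le_rfl
  have himm : ∀ x, Injective (mfderiv (𝓡 4) (𝓡 5) f x) := by
    intro x
    have hn : (∞ : ℕ∞ω) ≠ 0 := by simp
    have hd : MDifferentiableAt (𝓡 4) (𝓡 4) d x := d.contMDiffAt.mdifferentiableAt hn
    have hc : MDifferentiableAt (𝓡 4) (𝓡 5)
        (Subtype.val : sphere (0 : EuclideanSpace ℝ (Fin (4 + 1))) 1 → EuclideanSpace ℝ (Fin (4 + 1)))
        (d x) :=
      (contMDiff_coe_sphere (E := EuclideanSpace ℝ (Fin (4 + 1))) (n := 4)).mdifferentiableAt hn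
    rw [hfdef, mfderiv_comp x hc hd]
    exact (mfderiv_coe_sphere_injective (E := EuclideanSpace ℝ (Fin (4 + 1))) (n := 4) (d x)).comp
      (d.mfderivToContinuousLinearEquiv hn x).injective
  -- the induced metric `g = f^* ⟪·,·⟫` on `S`
  have hspace : (euclideanMetric (EuclideanSpace ℝ (Fin 5))).IsSpacelikeImmersion (𝓡 4) f := by
    refine ⟨hfm _ (le_of_eq rfl), fun y v hv ↦ ?_⟩
    rw [inducedBilin_apply, euclideanMetric_apply]
    have hne : mfderiv (𝓡 4) (𝓡 5) f y v ≠ 0 := fun h0 ↦ hv (himm y (by rw [h0, map_zero]))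
    exact real_inner_self_pos.mpr hne
  set g : PseudoRiemannianMetric (𝓡 4) ∞ (EuclideanSpace ℝ (Fin 4))
      (TangentSpace (𝓡 4) : S.carrier → Type _) :=
    (euclideanMetric (EuclideanSpace ℝ (Fin 5))).inducedMetric f contMDiff_pullbackBilin_holds hspace
    with hgdef
  have hgR : g.IsRiemannian := isRiemannian_inducedMetric _ _ contMDiff_pullbackBilin_holds hspace
  have hgval : ∀ (x : S.carrier) (v : TangentSpace (𝓡 4) x),
      g.val x v v = ‖(id (mfderiv (𝓡 4) (𝓡 5) f x v) : (EuclideanSpace ℝ (Fin 5)))‖ ^ 2 := by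
    intro x v
    rw [hgdef, inducedMetric_val, inducedBilin_apply, euclideanMetric_apply]
    exact real_inner_self_eq_norm_sq (id (mfderiv (𝓡 4) (𝓡 5) f x v) : (EuclideanSpace ℝ (Fin 5)))
  -- the witness: `W = ℍ⁵`, `G` the hyperbolic metric, `c = 1`, `Φ` the cone collar
  haveI := simplyConnectedSpace_top (V := (EuclideanSpace ℝ (Fin 5)))
  refine ⟨g, hgR, (⊤ : Opens (EuclideanSpace ℝ (Fin 5))), inferInstance, inferInstance, inferInstance,
    inferInstance, inferInstance, inferInstance, metric ⊤, isRiemannian_metric, 1,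
    fun p : S.carrier × ℝ ↦ (⟨(p.2)⁻¹ • f p.1, trivial⟩ : (⊤ : Opens (EuclideanSpace ℝ (Fin 5)))),
    one_pos,
    isCompact_setOf_edist_le_top, fun cov hcov x X Y ↦ sectionalCurvature_nonpos ⊤ cov hcov x X Y,
    coneCollar_contMDiffOn f hf, coneCollar_injOn f hinj h1,
    fun t ht ↦ isCompact_compl_image_coneCollar f h1 hsurj ht,
    fun t ht ↦ closure_image_coneCollar_subset f h1 hsurj ht, ?_⟩
  intro ε hε
  obtain ⟨t, ht, H⟩ := coneCollar_asymptotics f hf h1 ε hε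
  refine ⟨t, ht, fun x l hl v s ↦ ?_⟩
  rw [hgval x v]
  exact H x l hl v s

/-- **A refutation of the crux is a disproof of SPC4** (contrapositive of
`ahHadamardFilling_of_smoothPoincare4`): `¬ AhHadamardFilling → ¬ SmoothPoincare4`, i.e. an exotic
4-sphere. [folklore] -/
theorem not_smoothPoincare4_of_not_ahHadamardFilling
    (h : ¬ Summit.SmoothPoincare4.SmoothPoincare4.Theses.InformationMetricHadamard.AhHadamardFilling) :
    ¬ _root_.SmoothPoincare4 :=
  fun hS ↦ h (ahHadamardFilling_of_smoothPoincare4 hS)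

end Summit.SmoothPoincare4.SmoothPoincare4.Theorems.AhHadamardFilling.Negative

end
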